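import Summits.RiemannHypothesis.RiemannHypothesis.Theorems.WeilFormatCCinfMonomialAlgebra
import HarnessLib

/-!
# Format C, design C∞ (E3, analytic side): monomial-list algebra II — collection of the distributed brackets

Route context: Fourier–Galerkin / Schur-complement certificates of Weil positivity on a window ("format C", C∞ door;
cell memo `run/shared/lean/pub/rh-explicit/rh-explicit-weil-10/KERNEL-LEVER.md` §21; supporting stmt-RiemannHypothesis-0098;
seat rh-explicit-weil-10).  Continuation of `WeilFormatCCinfMonomialAlgebra` (generic `Finset` algebra, no analysis):

* `rowFlat_eq_collected` — the distributed row bracket (`rowFactored_eq_flat`) collected by power `d ≤ D` into the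
  two groups `Σ_d P₁(d)/m^d + S·Σ_d P_S(d)/m^d`, each `P(d)` a fiber sum over the index combinations of total power `d`;
* `imageFactoredGen_eq_flat` — `imageFactored_eq_flat` with a general polar exponent (even images `2r+2`, odd `2r+1`);
* `imageFlat_eq_collected` — the distributed image bracket collected by power into the four groups
  `Σ_d P₁(d)/m^d + L·Σ_d P_L(d)/m^d − C·Σ_d P_C(d)/m^d + S·Σ_d P_S(d)/m^d`.

These are the bridges from the printed monomial lists (`WeilFormatCCinfRowMonomials`, `WeilFormatCCinfImageMonomials`)
to the `ε_m Σ_f P(f)φ_f(m)` shape of `coupling_majorant_gram_shifted`.  Standard axioms; no definitions; no RH claim.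
-/

set_option autoImplicit false
-- `Summit.RiemannHypothesis.RiemannHypothesis.…` is the layout-mandated namespace (summit = problem name).
set_option linter.dupNamespace false

open Finset
open scoped BigOperators

namespace Summit.RiemannHypothesis.RiemannHypothesis.Theorems.WeilFormatC

/-! ## Rows -/

/-- Collecting the four pure groups and the `S`-group of a distributed row bracket (all powers `≤ D`). -/
theorem rowFlat_eq_collected (m S B₀ : ℝ) {J Kx R D : ℕ} (g h : ℕ → ℝ) (e eh : ℕ → ℕ) (s₀ : ℝ) (sN d' : ℕ → ℝ)
    (he : ∀ j ∈ Finset.range J, e j ≤ D) (hNe : ∀ p ∈ Finset.Icc 1 Kx ×ˢ Finset.range J, p.1 + e p.2 ≤ D)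
    (hre : ∀ p ∈ Finset.range R ×ˢ Finset.range J, (2 * p.1 + 1) + e p.2 ≤ D)
    (heh : ∀ r ∈ Finset.range J, eh r ≤ D) (hB : B₀ = ∑ r ∈ Finset.range J, h r / m ^ (eh r)) :
    (∑ j ∈ Finset.range J, (s₀ * g j / Real.pi) / m ^ (e j)
        + ∑ j ∈ Finset.range J, ∑ N ∈ Finset.Icc 1 Kx, (sN N * g j / Real.pi) / m ^ (N + e j)
        - ∑ j ∈ Finset.range J, ∑ r ∈ Finset.range R, (d' r * g j / Real.pi) / m ^ ((2 * r + 1) + e j))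
      + S * ∑ j ∈ Finset.range J, (g j / Real.pi) / m ^ (e j) + B₀
      = ∑ d ∈ Finset.range (D + 1),
          ((∑ j ∈ (Finset.range J).filter (fun j ↦ e j = d), s₀ * g j / Real.pi)
            + (∑ p ∈ (Finset.Icc 1 Kx ×ˢ Finset.range J).filter (fun p ↦ p.1 + e p.2 = d),
                sN p.1 * g p.2 / Real.pi)
            - (∑ p ∈ (Finset.range R ×ˢ Finset.range J).filter (fun p ↦ (2 * p.1 + 1) + e p.2 = d),
                d' p.1 * g p.2 / Real.pi)
            + (∑ r ∈ (Finset.range J).filter (fun r ↦ eh r = d), h r)) / m ^ d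
        + S * ∑ d ∈ Finset.range (D + 1), (∑ j ∈ (Finset.range J).filter (fun j ↦ e j = d), g j / Real.pi) / m ^ d := by
  rw [hB, sum_div_pow_eq_sum_fiber _ (fun j ↦ s₀ * g j / Real.pi) e he,
    sum_div_pow_eq_sum_fiber _ (fun j ↦ g j / Real.pi) e he,
    sum_div_pow_eq_sum_fiber _ h eh heh,
    Finset.sum_comm (s := Finset.range J) (t := Finset.Icc 1 Kx),
    sum_sum_div_pow_eq_sum_product _ _ (fun N j ↦ sN N * g j / Real.pi) (fun N j ↦ N + e j),
    sum_div_pow_eq_sum_fiber _ (fun p : ℕ × ℕ ↦ sN p.1 * g p.2 / Real.pi) (fun p ↦ p.1 + e p.2) hNe,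
    Finset.sum_comm (s := Finset.range J) (t := Finset.range R),
    sum_sum_div_pow_eq_sum_product _ _ (fun r j ↦ d' r * g j / Real.pi) (fun r j ↦ (2 * r + 1) + e j),
    sum_div_pow_eq_sum_fiber _ (fun p : ℕ × ℕ ↦ d' p.1 * g p.2 / Real.pi) (fun p ↦ (2 * p.1 + 1) + e p.2) hre]
  simp only [add_div, sub_div, Finset.sum_add_distrib, Finset.sum_sub_distrib]
  ring


/-! ## Images -/

/-- `imageFactored_eq_flat` with a general polar exponent `e_r` (even images: `2r+2`; odd images: `2r+1`). -/
theorem imageFactoredGen_eq_flat (m A L g₀ s₀ C S : ℝ) (n J Kx R : ℕ) (pe : ℕ → ℕ) (p ω w K α β : ℕ → ℝ)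
    (c sN d d' : ℕ → ℝ) (hw : ∀ k, w k = ω k / m ^ (k + 1)) :
    A * (∑ r ∈ Finset.range J, p r / m ^ (pe r))
        + ∑ k ∈ Finset.range n, w k *
            (K k + α k * ((L / 2 + g₀ + ∑ N ∈ Finset.Icc 1 Kx, c N / m ^ N
                              + ∑ r ∈ Finset.range R, d r / m ^ (2 * r + 2)) - C)
                 + β k * ((s₀ + ∑ N ∈ Finset.Icc 1 Kx, sN N / m ^ N
                              - ∑ r ∈ Finset.range R, d' r / m ^ (2 * r + 1)) + S))
      = (∑ r ∈ Finset.range J, (A * p r) / m ^ (pe r)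
          + ∑ k ∈ Finset.range n, (ω k * K k + ω k * α k * g₀ + ω k * β k * s₀) / m ^ (k + 1)
          + ∑ k ∈ Finset.range n, ∑ N ∈ Finset.Icc 1 Kx, (ω k * α k * c N) / m ^ (k + 1 + N)
          + ∑ k ∈ Finset.range n, ∑ r ∈ Finset.range R, (ω k * α k * d r) / m ^ (k + 1 + (2 * r + 2))
          + ∑ k ∈ Finset.range n, ∑ N ∈ Finset.Icc 1 Kx, (ω k * β k * sN N) / m ^ (k + 1 + N)
          - ∑ k ∈ Finset.range n, ∑ r ∈ Finset.range R, (ω k * β k * d' r) / m ^ (k + 1 + (2 * r + 1)))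
        + L * ∑ k ∈ Finset.range n, (ω k * α k / 2) / m ^ (k + 1)
        - C * ∑ k ∈ Finset.range n, (ω k * α k) / m ^ (k + 1)
        + S * ∑ k ∈ Finset.range n, (ω k * β k) / m ^ (k + 1) := by
  rw [Finset.sum_congr rfl fun k _ ↦ imageTerm_eq_flat m (ω k) (w k) (K k) (α k) (β k) L g₀ s₀ C S k Kx R
    c sN d d' (hw k)]
  rw [Finset.mul_sum, Finset.mul_sum, Finset.mul_sum, Finset.mul_sum]
  simp only [Finset.sum_add_distrib, Finset.sum_sub_distrib]
  have hA : ∑ r ∈ Finset.range J, A * (p r / m ^ (pe r)) = ∑ r ∈ Finset.range J, (A * p r) / m ^ (pe r) :=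
    Finset.sum_congr rfl fun r _ ↦ by ring
  rw [hA]
  ring

/-- **Collection of the distributed image bracket** (all powers `≤ D`). -/
theorem imageFlat_eq_collected (m A L g₀ s₀ C S : ℝ) {n J Kx R D : ℕ} (pe : ℕ → ℕ) (p ω K α β : ℕ → ℝ)
    (c sN d d' : ℕ → ℝ) (hpe : ∀ r ∈ Finset.range J, pe r ≤ D) (hn : ∀ k ∈ Finset.range n, k + 1 ≤ D)
    (hN : ∀ x ∈ Finset.range n ×ˢ Finset.Icc 1 Kx, x.1 + 1 + x.2 ≤ D)
    (hR : ∀ x ∈ Finset.range n ×ˢ Finset.range R, x.1 + 1 + (2 * x.2 + 2) ≤ D)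
    (hR' : ∀ x ∈ Finset.range n ×ˢ Finset.range R, x.1 + 1 + (2 * x.2 + 1) ≤ D) :
    (∑ r ∈ Finset.range J, (A * p r) / m ^ (pe r)
          + ∑ k ∈ Finset.range n, (ω k * K k + ω k * α k * g₀ + ω k * β k * s₀) / m ^ (k + 1)
          + ∑ k ∈ Finset.range n, ∑ N ∈ Finset.Icc 1 Kx, (ω k * α k * c N) / m ^ (k + 1 + N)
          + ∑ k ∈ Finset.range n, ∑ r ∈ Finset.range R, (ω k * α k * d r) / m ^ (k + 1 + (2 * r + 2))
          + ∑ k ∈ Finset.range n, ∑ N ∈ Finset.Icc 1 Kx, (ω k * β k * sN N) / m ^ (k + 1 + N)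
          - ∑ k ∈ Finset.range n, ∑ r ∈ Finset.range R, (ω k * β k * d' r) / m ^ (k + 1 + (2 * r + 1)))
        + L * ∑ k ∈ Finset.range n, (ω k * α k / 2) / m ^ (k + 1)
        - C * ∑ k ∈ Finset.range n, (ω k * α k) / m ^ (k + 1)
        + S * ∑ k ∈ Finset.range n, (ω k * β k) / m ^ (k + 1)
      = ∑ dd ∈ Finset.range (D + 1),
          ((∑ r ∈ (Finset.range J).filter (fun r ↦ pe r = dd), A * p r)
            + (∑ k ∈ (Finset.range n).filter (fun k ↦ k + 1 = dd), (ω k * K k + ω k * α k * g₀ + ω k * β k * s₀))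
            + (∑ x ∈ (Finset.range n ×ˢ Finset.Icc 1 Kx).filter (fun x ↦ x.1 + 1 + x.2 = dd), ω x.1 * α x.1 * c x.2)
            + (∑ x ∈ (Finset.range n ×ˢ Finset.range R).filter (fun x ↦ x.1 + 1 + (2 * x.2 + 2) = dd),
                ω x.1 * α x.1 * d x.2)
            + (∑ x ∈ (Finset.range n ×ˢ Finset.Icc 1 Kx).filter (fun x ↦ x.1 + 1 + x.2 = dd), ω x.1 * β x.1 * sN x.2)
            - (∑ x ∈ (Finset.range n ×ˢ Finset.range R).filter (fun x ↦ x.1 + 1 + (2 * x.2 + 1) = dd),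
                ω x.1 * β x.1 * d' x.2)) / m ^ dd
        + L * ∑ dd ∈ Finset.range (D + 1), (∑ k ∈ (Finset.range n).filter (fun k ↦ k + 1 = dd), ω k * α k / 2) / m ^ dd
        - C * ∑ dd ∈ Finset.range (D + 1), (∑ k ∈ (Finset.range n).filter (fun k ↦ k + 1 = dd), ω k * α k) / m ^ dd
        + S * ∑ dd ∈ Finset.range (D + 1), (∑ k ∈ (Finset.range n).filter (fun k ↦ k + 1 = dd), ω k * β k) / m ^ dd := by
  rw [sum_div_pow_eq_sum_fiber _ (fun r ↦ A * p r) pe hpe,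
    sum_div_pow_eq_sum_fiber _ (fun k ↦ ω k * K k + ω k * α k * g₀ + ω k * β k * s₀) (fun k ↦ k + 1) hn,
    sum_div_pow_eq_sum_fiber _ (fun k ↦ ω k * α k / 2) (fun k ↦ k + 1) hn,
    sum_div_pow_eq_sum_fiber _ (fun k ↦ ω k * α k) (fun k ↦ k + 1) hn,
    sum_div_pow_eq_sum_fiber _ (fun k ↦ ω k * β k) (fun k ↦ k + 1) hn,
    sum_sum_div_pow_eq_sum_product _ _ (fun k N ↦ ω k * α k * c N) (fun k N ↦ k + 1 + N),
    sum_div_pow_eq_sum_fiber _ (fun x : ℕ × ℕ ↦ ω x.1 * α x.1 * c x.2) (fun x ↦ x.1 + 1 + x.2) hN,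
    sum_sum_div_pow_eq_sum_product _ _ (fun k r ↦ ω k * α k * d r) (fun k r ↦ k + 1 + (2 * r + 2)),
    sum_div_pow_eq_sum_fiber _ (fun x : ℕ × ℕ ↦ ω x.1 * α x.1 * d x.2) (fun x ↦ x.1 + 1 + (2 * x.2 + 2)) hR,
    sum_sum_div_pow_eq_sum_product _ _ (fun k N ↦ ω k * β k * sN N) (fun k N ↦ k + 1 + N),
    sum_div_pow_eq_sum_fiber _ (fun x : ℕ × ℕ ↦ ω x.1 * β x.1 * sN x.2) (fun x ↦ x.1 + 1 + x.2) hN,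
    sum_sum_div_pow_eq_sum_product _ _ (fun k r ↦ ω k * β k * d' r) (fun k r ↦ k + 1 + (2 * r + 1)),
    sum_div_pow_eq_sum_fiber _ (fun x : ℕ × ℕ ↦ ω x.1 * β x.1 * d' x.2) (fun x ↦ x.1 + 1 + (2 * x.2 + 1)) hR']
  simp only [add_div, sub_div, Finset.sum_add_distrib, Finset.sum_sub_distrib]


end Summit.RiemannHypothesis.RiemannHypothesis.Theorems.WeilFormatC
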